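import Mathlib
import HarnessLib

/-!
# Kronecker bits II — parity of resolvents and the full-orbit generating series (algebraic core of stub KB4
# `fullOrbitSeries_eq_oddWeight_generating` of the line card `kronecker-bits`) for the seed crux `SignedMuSeedAtTwoPlus`
# stmt-BirchSwinnertonDyer-21438 (parent Kμ⁺ `SignedMuVanishingAtTwoPlus` stmt-BirchSwinnertonDyer-20689, route ResidualThetaTransportAtTwo)

Cell `bsd-wall`, width seat `bsd-wall-rtt-p4-w2` g16 (`--supports`, closes nothing).  THEOREMS ONLY; BSD is not proved by this.

Card `Cruxes/SignedMuSeedAtTwoPlus/Ideas/kronecker-bits.md` (k1 g26), dictionary (T0b)/KB4: with `G_β(z) = β E₁(βz) − Nβ E₁(z)`,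
the Taylor expansion `E₁(z + w) = Σ_j (−1)^j E_{j+1}(z) w^j` and the parity `E_k(−z) = (−1)^k E_k(z)`, the full-orbit series
`𝔉_β(w) = Σ_{c ∈ G} ε̄(c) G_β(z_c + w)` of an ODD character `ε` equals `Σ_{i ≥ 0} (β^{2i+1} ε(β) − Nβ)·R_{2i+1}·w^{2i}` with
`R_k = Σ_c ε̄(c) E_k(z_c)` the weight-`k` resolvents — the even weights drop out by parity and `(−1)^{2i} = 1`.
This file is the finite-sum / formal-power-series algebra of that statement, over an arbitrary finite abelian group `G`, an element
`m` (informally `−1`) with `m * m = 1`, `m ≠ 1`, a commutative ring `R`, a family `E : ℕ → G → R` (informally `E k c = E_k(z_c)`)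
with `E k (m c) = (−1)^k E k c`, and a character `ε : G →* Rˣ` with `ε m = −1`:

* `sum_eq_zero_of_anti_invol` — a function with `f (m c) = −f c` has full-orbit sum EXACTLY `0` (pairing `c ↔ m c`,
  `Finset.sum_involution`; no division by `2`);
* `inv_char_mul_anti`, **`resolvent_eq_zero_of_invariant`**, **`resolvent_eq_zero_of_even_weight`** — against an odd character the
  resolvent of an `m`-INVARIANT function vanishes; in particular `R_k = 0` for every even weight `k`;
* `twisted_sum_reindex` — `Σ_c ε(c)⁻¹ F(βc) = ε(β) Σ_c ε(c)⁻¹ F(c)`;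
* **`fullOrbit_generating`** — KB4's algebraic core in `R⟦X⟧`:
  `Σ_c C(ε(c)⁻¹) · mk (j ↦ (−1)^j (b^{j+1} E_{j+1}(βc) − N E_{j+1}(c))) = mk (j ↦ [j even] (b^{j+1} ε(β) − N) R_{j+1})`,
  with `fullOrbit_generating_coeff_odd` (the series is even) and `fullOrbit_generating_coeff_zero` (its constant term is
  `(b ε(β) − N)·R₁`, i.e. twice the level-`0` quantity `(α ε(α) − Nα) Λ` of T0 at `α = β`).

The substitution `w = λ(t)` (formal logarithm) and the integrality/reduction half of KB4 are not addressed here. [folklore]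
-/

set_option autoImplicit false
-- the Theorems namespace of this sub repeats the summit name by design (D-0017 nested layout)
set_option linter.dupNamespace false

open Finset

namespace Summit.BirchSwinnertonDyer.BirchSwinnertonDyer.Theorems.SignedMuAtTwo.KroneckerBits

/-! ## Parity: anti-invariant summands and even-weight resolvents -/

section Parity

variable {G : Type*} [CommGroup G] {m : G}

/-- A function with `f (m c) = −f c` for an `m` with `m * m = 1`, `m ≠ 1` has full-orbit sum exactly `0`
(pair `c` with `m c`; `Finset.sum_involution`, no division by `2`). [folklore] -/
theorem sum_eq_zero_of_anti_invol [Fintype G] {M : Type*} [AddCommMonoid M] (f : G → M)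
    (hf : ∀ c, f c + f (m * c) = 0) (hm : m * m = 1) (hm1 : m ≠ 1) : ∑ c, f c = 0 :=
  sum_involution (fun c _ => m * c) (fun c _ => hf c)
    (fun c _ _ h => hm1 (mul_right_cancel (h.trans (one_mul c).symm)))
    (fun c _ => mem_univ _)
    (fun c _ => by rw [← mul_assoc, hm, one_mul])

/-- Group form of `sum_eq_zero_of_anti_invol`: `f (m c) = −f c` ⇒ `Σ_c f c = 0`. [folklore] -/
theorem sum_eq_zero_of_anti_invol' [Fintype G] {M : Type*} [AddCommGroup M] (f : G → M)
    (hf : ∀ c, f (m * c) = -f c) (hm : m * m = 1) (hm1 : m ≠ 1) : ∑ c, f c = 0 :=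
  sum_eq_zero_of_anti_invol f (fun c => by rw [hf, add_neg_cancel]) hm hm1

variable {R : Type*} [CommRing R]

/-- Against an ODD character (`ε m = −1`) an `m`-invariant function has anti-invariant weighted summand
`ε(mc)⁻¹ E(mc) = −ε(c)⁻¹ E(c)`. [folklore] -/
theorem inv_char_mul_anti (E : G → R) (ε : G →* Rˣ) (hE : ∀ c, E (m * c) = E c) (hε : ε m = -1) (c : G) :
    (((ε (m * c))⁻¹ : Rˣ) : R) * E (m * c) = -((((ε c)⁻¹ : Rˣ) : R) * E c) := by
  rw [map_mul, hε, mul_inv_rev, inv_neg, inv_one, Units.val_mul, Units.val_neg, Units.val_one, hE]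
  ring

/-- **The resolvent of an invariant function against an odd character vanishes**: `Σ_c ε(c)⁻¹ E(c) = 0` when
`E (m c) = E c`, `ε m = −1`, `m * m = 1`, `m ≠ 1`. [folklore] -/
theorem resolvent_eq_zero_of_invariant [Fintype G] (E : G → R) (ε : G →* Rˣ) (hE : ∀ c, E (m * c) = E c)
    (hε : ε m = -1) (hm : m * m = 1) (hm1 : m ≠ 1) :
    ∑ c, (((ε c)⁻¹ : Rˣ) : R) * E c = 0 :=
  sum_eq_zero_of_anti_invol' (fun c => (((ε c)⁻¹ : Rˣ) : R) * E c) (inv_char_mul_anti E ε hE hε) hm hm1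

/-- **Even-weight resolvents vanish**: for a family with `E k (m c) = (−1)^k E k c` (informally `E_k(−z) = (−1)^k E_k(z)`) and an
odd character, `R_k = Σ_c ε(c)⁻¹ E_k(c) = 0` for every EVEN `k`. [folklore] -/
theorem resolvent_eq_zero_of_even_weight [Fintype G] (E : ℕ → G → R) (ε : G →* Rˣ)
    (hpar : ∀ k c, E k (m * c) = (-1) ^ k * E k c) (hε : ε m = -1) (hm : m * m = 1) (hm1 : m ≠ 1)
    {k : ℕ} (hk : Even k) :
    ∑ c, (((ε c)⁻¹ : Rˣ) : R) * E k c = 0 :=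
  resolvent_eq_zero_of_invariant (E k) ε (fun c => by rw [hpar, hk.neg_one_pow, one_mul]) hε hm hm1

end Parity

/-! ## The full-orbit generating series (KB4, algebraic core) -/

section Generating

variable {G R : Type*} [CommGroup G] [Fintype G] [CommRing R] {m : G}

/-- Twisted re-indexing `c ↦ β c`: `Σ_c ε(c)⁻¹ F(βc) = ε(β) Σ_c ε(c)⁻¹ F(c)`. [folklore] -/
theorem twisted_sum_reindex (F : G → R) (ε : G →* Rˣ) (β : G) :
    ∑ c, (((ε c)⁻¹ : Rˣ) : R) * F (β * c) = (ε β : R) * ∑ c, (((ε c)⁻¹ : Rˣ) : R) * F c := by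
  have hu : (ε β : R) * (((ε β)⁻¹ : Rˣ) : R) = 1 := Units.mul_inv _
  calc ∑ c, (((ε c)⁻¹ : Rˣ) : R) * F (β * c)
      = ∑ c, (ε β : R) * ((((ε (β * c))⁻¹ : Rˣ) : R) * F (β * c)) := by
        refine Fintype.sum_congr _ _ fun c => ?_
        rw [map_mul, mul_inv_rev, Units.val_mul]
        linear_combination (-((((ε c)⁻¹ : Rˣ) : R) * F (β * c))) * hu
    _ = (ε β : R) * ∑ c, (((ε (β * c))⁻¹ : Rˣ) : R) * F (β * c) := by rw [mul_sum]
    _ = (ε β : R) * ∑ c, (((ε c)⁻¹ : Rˣ) : R) * F c := by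
        congr 1
        exact Fintype.sum_equiv (Equiv.mulLeft β) _ _ fun c => rfl

/-- The weight-`j+1` coefficient of the full-orbit series: `Σ_c ε(c)⁻¹ (b^{j+1} E_{j+1}(βc) − N E_{j+1}(c)) = (b^{j+1} ε(β) − N) R_{j+1}`. [folklore] -/
theorem fullOrbit_coeff_reindex (E : ℕ → G → R) (ε : G →* Rˣ) (β : G) (b N : R) (j : ℕ) :
    ∑ c, (((ε c)⁻¹ : Rˣ) : R) * (b ^ (j + 1) * E (j + 1) (β * c) - N * E (j + 1) c)
      = (b ^ (j + 1) * (ε β : R) - N) * ∑ c, (((ε c)⁻¹ : Rˣ) : R) * E (j + 1) c := by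
  have h1 := twisted_sum_reindex (E (j + 1)) ε β
  have h2 : ∑ c, (((ε c)⁻¹ : Rˣ) : R) * (b ^ (j + 1) * E (j + 1) (β * c) - N * E (j + 1) c)
      = b ^ (j + 1) * ∑ c, (((ε c)⁻¹ : Rˣ) : R) * E (j + 1) (β * c)
          - N * ∑ c, (((ε c)⁻¹ : Rˣ) : R) * E (j + 1) c := by
    rw [mul_sum, mul_sum, ← sum_sub_distrib]
    exact sum_congr rfl fun c _ => by ring
  rw [h2, h1]
  ring

/-- **Full-orbit generating series = odd-weight resolvents** (algebraic core of KB4 / (T0b)).  In `R⟦X⟧`, with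
`R_k = Σ_c ε(c)⁻¹ E_k(c)`:
`Σ_c C(ε(c)⁻¹) · mk (j ↦ (−1)^j (b^{j+1} E_{j+1}(βc) − N E_{j+1}(c))) = mk (j ↦ if j is even then (b^{j+1} ε(β) − N) R_{j+1} else 0)`;
informally the left side is `Σ_c ε̄(c) G_β(z_c + w)` expanded by `E₁(z + w) = Σ_j (−1)^j E_{j+1}(z) w^j`, and the right side is
`Σ_i (β^{2i+1} ε(β) − Nβ) R_{2i+1} w^{2i}`.  Even weights vanish by `resolvent_eq_zero_of_even_weight`. [folklore] -/
theorem fullOrbit_generating (E : ℕ → G → R) (ε : G →* Rˣ) (β : G) (b N : R)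
    (hpar : ∀ k c, E k (m * c) = (-1) ^ k * E k c) (hε : ε m = -1) (hm : m * m = 1) (hm1 : m ≠ 1) :
    ∑ c, PowerSeries.C (((ε c)⁻¹ : Rˣ) : R) *
        PowerSeries.mk (fun j => (-1) ^ j * (b ^ (j + 1) * E (j + 1) (β * c) - N * E (j + 1) c))
      = PowerSeries.mk (fun j => if Even j then
          (b ^ (j + 1) * (ε β : R) - N) * ∑ c, (((ε c)⁻¹ : Rˣ) : R) * E (j + 1) c else 0) := by
  ext j
  rw [map_sum, PowerSeries.coeff_mk]
  simp only [PowerSeries.coeff_C_mul, PowerSeries.coeff_mk]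
  have hfac : ∑ c, (((ε c)⁻¹ : Rˣ) : R) * ((-1) ^ j * (b ^ (j + 1) * E (j + 1) (β * c) - N * E (j + 1) c))
      = (-1) ^ j * ∑ c, (((ε c)⁻¹ : Rˣ) : R) * (b ^ (j + 1) * E (j + 1) (β * c) - N * E (j + 1) c) := by
    rw [mul_sum]
    exact sum_congr rfl fun c _ => by ring
  rw [hfac, fullOrbit_coeff_reindex]
  rcases Nat.even_or_odd j with hj | hj
  · rw [if_pos hj, hj.neg_one_pow, one_mul]
  · rw [if_neg (Nat.not_even_iff_odd.mpr hj),
      resolvent_eq_zero_of_even_weight E ε hpar hε hm hm1 (Odd.add_one hj), mul_zero, mul_zero]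

/-- The full-orbit generating series is EVEN: its odd coefficients vanish. [folklore] -/
theorem fullOrbit_generating_coeff_odd (E : ℕ → G → R) (ε : G →* Rˣ) (β : G) (b N : R)
    (hpar : ∀ k c, E k (m * c) = (-1) ^ k * E k c) (hε : ε m = -1) (hm : m * m = 1) (hm1 : m ≠ 1)
    {j : ℕ} (hj : Odd j) :
    PowerSeries.coeff j (∑ c, PowerSeries.C (((ε c)⁻¹ : Rˣ) : R) *
        PowerSeries.mk (fun j => (-1) ^ j * (b ^ (j + 1) * E (j + 1) (β * c) - N * E (j + 1) c))) = 0 := by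
  rw [fullOrbit_generating E ε β b N hpar hε hm hm1, PowerSeries.coeff_mk, if_neg (Nat.not_even_iff_odd.mpr hj)]

/-- The constant term of the full-orbit generating series is `(b ε(β) − N) · R₁` — twice T0's level-`0` quantity
`(α ε(α) − Nα) Λ` at `α = β` (`R₁ = 2Λ` for the half-orbit resolvent `Λ`). [folklore] -/
theorem fullOrbit_generating_coeff_zero (E : ℕ → G → R) (ε : G →* Rˣ) (β : G) (b N : R)
    (hpar : ∀ k c, E k (m * c) = (-1) ^ k * E k c) (hε : ε m = -1) (hm : m * m = 1) (hm1 : m ≠ 1) :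
    PowerSeries.coeff 0 (∑ c, PowerSeries.C (((ε c)⁻¹ : Rˣ) : R) *
        PowerSeries.mk (fun j => (-1) ^ j * (b ^ (j + 1) * E (j + 1) (β * c) - N * E (j + 1) c)))
      = (b * (ε β : R) - N) * ∑ c, (((ε c)⁻¹ : Rˣ) : R) * E 1 c := by
  rw [fullOrbit_generating E ε β b N hpar hε hm hm1, PowerSeries.coeff_mk, if_pos Even.zero, zero_add, pow_one]

end Generating

end Summit.BirchSwinnertonDyer.BirchSwinnertonDyer.Theorems.SignedMuAtTwo.KroneckerBits

/-! ## Appendix — operator form: the full-orbit series is a twisted coboundary of ONE β-free series (KB4 ⟹ law (B) with the class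
series NAMED as the odd-weight resolvent generating function) -/

namespace Summit.BirchSwinnertonDyer.BirchSwinnertonDyer.Theorems.SignedMuAtTwo.KroneckerBits

section OperatorForm

variable {G R : Type*} [CommGroup G] [Fintype G] [CommRing R] {m : G}

/-- Coefficients of the β-free RESOLVENT GENERATING SERIES `𝒢 = mk (j ↦ [j even] R_{j+1})`, `R_k = Σ_c ε(c)⁻¹ E_k(c)`, after rescaling by `b`:
`[X^j] rescale b 𝒢 = [j even] b^j R_{j+1}`. [folklore] -/
theorem coeff_rescale_resolventSeries (E : ℕ → G → R) (ε : G →* Rˣ) (b : R) (j : ℕ) :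
    PowerSeries.coeff j (PowerSeries.rescale b
        (PowerSeries.mk fun j => if Even j then ∑ c, (((ε c)⁻¹ : Rˣ) : R) * E (j + 1) c else 0))
      = if Even j then b ^ j * ∑ c, (((ε c)⁻¹ : Rˣ) : R) * E (j + 1) c else 0 := by
  rw [PowerSeries.coeff_rescale, PowerSeries.coeff_mk]
  split_ifs <;> simp

/-- **Operator form of KB4 (characteristic-`0` avatar of the operator coboundary law (B) of `smoothing-coboundary`, class series NAMED).**
With the β-FREE series `𝒢 := mk (j ↦ [j even]·R_{j+1})` (the generating function of the odd-weight resolvents `R_{2i+1}`), the full-orbit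
series of EVERY smoothing `β` is the twisted coboundary
`Σ_c C(ε(c)⁻¹)·mk(j ↦ (−1)^j (b^{j+1}E_{j+1}(βc) − N E_{j+1}(c))) = C(b ε(β))·(rescale b 𝒢) − C(N)·𝒢`;
informally `𝔉_β(w) = β ε(β)·𝒢(βw) − Nβ·𝒢(w)`, and after `w = λ(t)` the rescaling `w ↦ βw` is `t ↦ [β](t)` — the operator `η(β)ρ(β) − 1` of law (B)
with `G_χ ↔ 𝒢∘λ`. [folklore] -/
theorem fullOrbit_generating_operator_form (E : ℕ → G → R) (ε : G →* Rˣ) (β : G) (b N : R)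
    (hpar : ∀ k c, E k (m * c) = (-1) ^ k * E k c) (hε : ε m = -1) (hm : m * m = 1) (hm1 : m ≠ 1) :
    ∑ c, PowerSeries.C (((ε c)⁻¹ : Rˣ) : R) *
        PowerSeries.mk (fun j => (-1) ^ j * (b ^ (j + 1) * E (j + 1) (β * c) - N * E (j + 1) c))
      = PowerSeries.C (b * (ε β : R)) * PowerSeries.rescale b
            (PowerSeries.mk fun j => if Even j then ∑ c, (((ε c)⁻¹ : Rˣ) : R) * E (j + 1) c else 0)
        - PowerSeries.C N
            * (PowerSeries.mk fun j => if Even j then ∑ c, (((ε c)⁻¹ : Rˣ) : R) * E (j + 1) c else 0) := by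
  rw [fullOrbit_generating E ε β b N hpar hε hm hm1]
  ext j
  rw [map_sub, PowerSeries.coeff_C_mul, PowerSeries.coeff_C_mul, coeff_rescale_resolventSeries, PowerSeries.coeff_mk,
    PowerSeries.coeff_mk]
  split_ifs <;> ring

/-- The β-free series is RECOVERED from the full-orbit series of one smoothing coefficientwise:
`[X^j] 𝔉_β = (b^{j+1} ε(β) − N)·[X^j] 𝒢` — so wherever the factors `b^{2i+1}ε(β) − N` are non-zero-divisors (characteristic `0`: absolute values
`|β|^{2i+1} ≠ |β|²`), `𝒢` and hence every other `𝔉_{β'}` is determined by `𝔉_β` (the Mahler-system rigidity (D) in characteristic `0`). [folklore] -/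
theorem coeff_fullOrbit_eq_factor_mul_coeff_resolventSeries (E : ℕ → G → R) (ε : G →* Rˣ) (β : G) (b N : R)
    (hpar : ∀ k c, E k (m * c) = (-1) ^ k * E k c) (hε : ε m = -1) (hm : m * m = 1) (hm1 : m ≠ 1) (j : ℕ) :
    PowerSeries.coeff j (∑ c, PowerSeries.C (((ε c)⁻¹ : Rˣ) : R) *
        PowerSeries.mk (fun j => (-1) ^ j * (b ^ (j + 1) * E (j + 1) (β * c) - N * E (j + 1) c)))
      = (b ^ (j + 1) * (ε β : R) - N) * PowerSeries.coeff j
          (PowerSeries.mk fun j => if Even j then ∑ c, (((ε c)⁻¹ : Rˣ) : R) * E (j + 1) c else (0 : R)) := by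
  rw [fullOrbit_generating E ε β b N hpar hε hm hm1, PowerSeries.coeff_mk, PowerSeries.coeff_mk]
  split_ifs <;> ring

end OperatorForm

end Summit.BirchSwinnertonDyer.BirchSwinnertonDyer.Theorems.SignedMuAtTwo.KroneckerBits
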